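import Summits.BirchSwinnertonDyer.Rank1Residual.Supersingular.KobayashiMainConjecture
import Literature.NumberTheory.EllipticCurves.Kobayashi2003.SignedSelmerGeneratorChangeProofs
import Literature.NumberTheory.EllipticCurves.KatoRankBoundProofs
import HarnessLib

/-!
# Route `ThetaPartnerAtTwo`, crux K2r `SignedMainConjectureCMTwoRankZero` (item stmt-BirchSwinnertonDyer-20312):
# stub `stub_generatorChangeCMTwo` of line `rankzero` — PROVED

HONEST FRAMING (cell `pub/bsd-wall`, W-ALL row 1, prover seat `bsd-wall-tp2-p2`, successor g1): the
restated crux (K2 behind `A.analyticRank = 0`, rev 13) asks, in its first conjunct, for `X⁺(A/ℚ_∞)`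
torsion with `μ⁺ = 0` at EVERY cyclotomic top-generator pair `(κ, γ)`, while Kobayashi's main
conjecture (second conjunct, and the source of `μ⁺ = 0` in the skeleton `rankzero`, p518019 §4) speaks
only at NORMALISED pairs (`IsCyclotomicVariable 2 γ`). The registered stub `stub_generatorChangeCMTwo`
(skeleton sha16 eb6103e9619f0e2d) is the passage from normalised pairs to all pairs, given torsion at
all pairs (the torsion stub). It is infrastructure, not arithmetic, and is proved here for the record
from the Literature theorem `Kobayashi2003.SignedSelmerDualData.mu_eq_zero_of_mu_eq_zero_of_isCyclotomic`
(`SignedSelmerGeneratorChangeProofs.lean`, this seat: two cyclotomic data differ by a unit twist, the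
signed Selmer groups are identified by restriction along the equal kernels, the Pontryagin duals become
`ℤ₂`-linearly isomorphic, and "`μ = 0` ⟺ finitely generated over `ℤ₂`" transports) and the tree's
normalised pair `exists_isCyclotomic_isTopGenerator_isCyclotomicVariable_holds 2`. The CM / rank /
reduction binders of the stub are not used (the statement holds for every curve). Nothing about any
curve's Selmer group is asserted.

References: [Kobayashi2003] Def. 1.1, Thm. 1.2/1.4 (objects only); [GreenbergLNM1716] §1 p. 60;
[Washington1997] §13.1–13.2.
-/

set_option autoImplicit false
-- the Theorems namespace of this sub repeats the summit name by design (D-0017 nested layout)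
set_option linter.dupNamespace false

noncomputable section

open scoped Classical

open WeierstrassCurve Literature.NumberTheory.EllipticCurves
  Literature.NumberTheory.EllipticCurves.Rank1Residual
  Literature.NumberTheory.EllipticCurves.Kobayashi2003 ZpExtension

namespace Summit.BirchSwinnertonDyer.BirchSwinnertonDyer.Theorems

/-- **Stub `stub_generatorChangeCMTwo` of line `rankzero` (crux stmt-BirchSwinnertonDyer-20312), by
name and signature.** For a CM curve `A/ℚ` good supersingular at `2` with `a₂ = 0` and analytic rank
`0` (binders unused): if every signed dual datum at every cyclotomic top-generator pair is `Λ`-torsion,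
and `μ⁺ = 0` holds at every NORMALISED pair (`IsCyclotomicVariable 2 γ`), then `μ⁺ = 0` holds at every
cyclotomic top-generator pair — by `SignedSelmerDualData.mu_eq_zero_of_mu_eq_zero_of_isCyclotomic`
applied to the canonical datum at the tree's normalised pair. [cite: GreenbergLNM1716, §1 p. 60]
[cite: Washington1997, §13.2] [cite: Kobayashi2003, Def. 1.1 and Thm. 1.4 (the invariants only)] -/
theorem stub_generatorChangeCMTwo :
    ∀ (A : WeierstrassCurve ℚ) [A.IsElliptic] [A.IsGloballyMinimal],
      A.HasCM → A.analyticRank = 0 → GoodSS A 2 → A.frobeniusTrace 2 = 0 →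
      (∀ (κ : ZpExtension ℚ 2) (γ : Field.absoluteGaloisGroup ℚ), κ.IsCyclotomic → κ.IsTopGenerator γ →
        ∀ D : SignedSelmerDualData A κ γ 1, Module.IsTorsion (IwasawaAlgebra 2) D.X) →
      (∀ (κ : ZpExtension ℚ 2) (γ : Field.absoluteGaloisGroup ℚ),
        κ.IsCyclotomic → κ.IsTopGenerator γ → IsCyclotomicVariable 2 γ →
        ∀ D : SignedSelmerDualData A κ γ 1, D.mu = 0) →
      ∀ (κ : ZpExtension ℚ 2) (γ : Field.absoluteGaloisGroup ℚ), κ.IsCyclotomic → κ.IsTopGenerator γ →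
      ∀ D : SignedSelmerDualData A κ γ 1, D.mu = 0 := by
  intro A _ _ _ _ _ _ hT hμ κ γ hκ hγ D
  obtain ⟨κ₀, hκ₀, γ₀, hγ₀, hγ₀'⟩ := exists_isCyclotomic_isTopGenerator_isCyclotomicVariable_holds 2
  obtain ⟨D₀⟩ := nonempty_signedSelmerDualData A κ₀ (1 : ℤˣ) hγ₀
  exact SignedSelmerDualData.mu_eq_zero_of_mu_eq_zero_of_isCyclotomic hκ₀ hκ hγ₀ hγ D₀ D
    (hT κ₀ γ₀ hκ₀ hγ₀ D₀) (hμ κ₀ γ₀ hκ₀ hγ₀ hγ₀' D₀)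

/-- **The same for every curve, every sign** (the arithmetic binders of the stub play no role): for
`W/ℚ` globally minimal and `ε = ±1`, torsion of every signed dual datum at every cyclotomic
top-generator pair + `μ^ε = 0` at normalised pairs ⇒ `μ^ε = 0` at every cyclotomic top-generator pair.
[cite: GreenbergLNM1716, §1 p. 60] [cite: Washington1997, §13.2] -/
theorem signedMu_eq_zero_of_normalised {p : ℕ} [Fact p.Prime] (W : WeierstrassCurve ℚ) [W.IsElliptic]
    (ε : ℤˣ)
    (hT : ∀ (κ : ZpExtension ℚ p) (γ : Field.absoluteGaloisGroup ℚ), κ.IsCyclotomic → κ.IsTopGenerator γ →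
      ∀ D : SignedSelmerDualData W κ γ ε, Module.IsTorsion (IwasawaAlgebra p) D.X)
    (hμ : ∀ (κ : ZpExtension ℚ p) (γ : Field.absoluteGaloisGroup ℚ),
      κ.IsCyclotomic → κ.IsTopGenerator γ → IsCyclotomicVariable p γ →
      ∀ D : SignedSelmerDualData W κ γ ε, D.mu = 0)
    {κ : ZpExtension ℚ p} {γ : Field.absoluteGaloisGroup ℚ} (hκ : κ.IsCyclotomic)
    (hγ : κ.IsTopGenerator γ) (D : SignedSelmerDualData W κ γ ε) : D.mu = 0 := by
  obtain ⟨κ₀, hκ₀, γ₀, hγ₀, hγ₀'⟩ := exists_isCyclotomic_isTopGenerator_isCyclotomicVariable_holds p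
  obtain ⟨D₀⟩ := nonempty_signedSelmerDualData W κ₀ ε hγ₀
  exact SignedSelmerDualData.mu_eq_zero_of_mu_eq_zero_of_isCyclotomic hκ₀ hκ hγ₀ hγ D₀ D
    (hT κ₀ γ₀ hκ₀ hγ₀ D₀) (hμ κ₀ γ₀ hκ₀ hγ₀ hγ₀' D₀)

end Summit.BirchSwinnertonDyer.BirchSwinnertonDyer.Theorems

end
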